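import Mathlib
import Summits.Ventures.HodgeRepro0.P4RowDIsolationData

/-!
# P4RowDIsolation — the numerical core of P4-RowD-Candidate-v1 (§1.3, §6.2) as a kernel-checked certificate (p4, generation 11)

Setting. `A₀ = E₁(x) × E₂(y) × E₁(u₁) × E₁(u₂) × E₂(v₁) × E₂(v₂)` with `H₁(A₀, ℤ) = ℤ¹²` (two coordinates per slot, in the order
x, y, u₁, u₂, v₁, v₂; bases (1, i) for E₁ = ℂ/ℤ[i] and (1, ζ₃) for E₂ = ℂ/ℤ[ζ₃]). A divisor class is an integer alternating
form `E` on `ℤ¹²` (a 12 × 12 antisymmetric integer matrix, `E[p][q] = E(e_p, e_q)`). `J′` = multiplication by `i` on the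
E₁-slots and by `√−3 = 2ζ₃ + 1` on the E₂-slots (an integer matrix, a positive multiple of the complex structure on each
factor). The POSITIVITY FORM of `E` is the symmetric matrix `P_E(a, b) = E(e_a, J′ e_b) = Σ_c E[a][c] J′[c][b]`; a class is
ample iff `P_E` is positive definite (Riemann's conditions), and the complex index of a class is half the number of
negative eigenvalues of `P_E` (the real form has its eigenvalues in pairs).

DATA (module P4RowDIsolationData, transcribed from proofs/p4-scripts/rowd/gen_lean_isolation.py at α = 6 + 1√3 — nothing
is computed outside Lean except the CHOICE of the witness vectors): `J`, `theta0`, `cls` (the 32 classes `±m_a`, `m_a = Γ_a + s_aΓ′_a`),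
`isolatedIdx` (the eight classes `Γ_a + Γ′_a`), `wTheta` / `wThetaAdj` / `dTheta` (a basis `W` with `W · P_Θ₀ · Wᵀ` diagonal positive
and `W · Wadj = d · I`, `d ≠ 0`), `witJk` / `witVk` (for the `k`-th isolated class and each other class `j`: four vectors whose Gram
matrix for the positivity form of `cls[j] − cls[i]` is negative definite — Sylvester on its negative).

CERTIFIED (`decide +kernel`, axioms `propext` only):
* (D) `data_wellformed`: the shapes, `theta0` and every `cls[k]` antisymmetric, `cls[2a+1] = −cls[2a]`, eight even isolated indices;
* (Θ) `theta0_positive_definite`: `P_Θ₀` is POSITIVE DEFINITE, i.e. `Θ₀ = pt_x + pt_y + E_α` is ample — page §1.3;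
* (I) `isolation_0 … isolation_7`, `isolation_all`: for each of the eight classes `Γ_a + Γ′_a` and each of the 31 other classes
  `l′` of the rank-32 shape, the positivity form of `l′ − (Γ_a + Γ′_a)` has a 4-dimensional negative definite subspace, i.e.
  real negative inertia ≥ 4, i.e. complex index ≥ 2 — page §6.2: with Mumford's index theorem this is `Hom = Ext¹ = 0` from
  `O(Γ_a + Γ′_a)` to every other piece, the ISOLATION of the eight positive pieces in every iterated extension of the 32 line
  bundles (Corollary 7′ of the page).

NOT certified: Mumford's index theorem itself; the exterior-algebra identities of Lemma 1; the Fourier–Mukai and annihilator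
computations (Propositions 3–4); the sixteen deciding classes `η_Sh ⌟ m_a` (obstruction.py); the thresholds N₀, t₀ beyond `Θ₀`.
-/

namespace HodgeRepro0.P4RowDIsolation

/-! ## Linear algebra over ℤ (lists) -/

/-- entry `(r, c)` of a list-matrix, `0` outside -/
def get (M : List (List Int)) (r c : Nat) : Int := (M.getD r []).getD c 0
/-- the dot product of two integer vectors -/
def dot (v w : List Int) : Int := (List.zipWith (· * ·) v w).foldl (· + ·) 0
/-- matrix times column vector -/
def matVec (M : List (List Int)) (v : List Int) : List Int := M.map (fun row => dot row v)
/-- the positivity form `P_E(a, b) = Σ_c E[a][c] · J[c][b]` of a class `E`, as a 12 × 12 matrix -/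
def pform (E : List (List Int)) : List (List Int) :=
  (List.range 12).map (fun a => (List.range 12).map (fun b => ((List.range 12).map (fun c => get E a c * get J c b)).foldl (· + ·) 0))
/-- `vᵀ · P · w` -/
def bil (P : List (List Int)) (v w : List Int) : Int := dot v (matVec P w)
/-- a 12 × 12 list-matrix -/
def isSquare12 (M : List (List Int)) : Bool := M.length == 12 && M.all (fun row => row.length == 12)
/-- antisymmetry of a 12 × 12 list-matrix -/
def antisym (E : List (List Int)) : Bool :=
  isSquare12 E && (List.range 12).all (fun a => (List.range 12).all (fun b => get E a b == - get E b a))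
/-- entrywise difference -/
def matSub (A B : List (List Int)) : List (List Int) := List.zipWith (fun ra rb => List.zipWith (· - ·) ra rb) A B
/-- entrywise negation -/
def neg (A : List (List Int)) : List (List Int) := A.map (fun row => row.map (fun x => -x))
/-- determinant by Laplace expansion along the first row (small matrices only; `fuel` ≥ the size) -/
def det : Nat → List (List Int) → Int
  | 0, _ => 1
  | _ + 1, [] => 1
  | fuel + 1, row :: rest =>
    let n := row.length
    ((List.range n).map (fun c =>
      let minor := rest.map (fun r => (r.take c) ++ (r.drop (c + 1)))
      (if c % 2 == 0 then 1 else -1) * row.getD c 0 * det fuel minor)).foldl (· + ·) 0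
/-- the leading principal `k × k` submatrix -/
def lead (G : List (List Int)) (k : Nat) : List (List Int) := (G.take k).map (fun row => row.take k)
/-- Sylvester's criterion: all leading principal minors positive -/
def posDefSylvester (G : List (List Int)) : Bool :=
  (List.range G.length).all (fun k => det (k + 1) (lead G (k + 1)) > 0)
/-- the Gram matrix of the vectors `vs` for the form `P` -/
def gram (P : List (List Int)) (vs : List (List Int)) : List (List Int) := vs.map (fun v => vs.map (fun w => bil P v w))
/-- `Θ₀`: `W · P · Wᵀ` diagonal with positive diagonal, and `W · Wadj = d · I` with `d ≠ 0` -/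
def thetaCheck : Bool :=
  let P := pform theta0
  let G := gram P wTheta
  (List.range 12).all (fun a => (List.range 12).all (fun b => if a == b then get G a b > 0 else get G a b == 0)) &&
  (List.range 12).all (fun a => (List.range 12).all (fun b =>
     ((List.range 12).map (fun k => get wTheta a k * get wThetaAdj k b)).foldl (· + ·) 0 == (if a == b then dTheta else 0))) &&
  dTheta != 0
/-- the `n`-th witness of the isolated class `i`: `i ≠ j`, both indices < 32, four vectors of length 12, and `−gram` positive definite (Sylvester) -/
def witCheck (i : Nat) (wj : List Nat) (wv : List (List (List Int))) (n : Nat) : Bool :=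
  let j := wj.getD n 99; let vs := wv.getD n []
  i != j && i < 32 && j < 32 && vs.length == 4 && vs.all (fun v => v.length == 12) &&
  posDefSylvester (neg (gram (pform (matSub (cls.getD j []) (cls.getD i []))) vs))
/-- the 31 witnesses of the isolated class `i` cover every `j ≠ i` -/
def witCovers (i : Nat) (wj : List Nat) : Bool :=
  wj.length == 31 && (List.range 32).all (fun j => j == i || wj.contains j)
/-- all 31 witnesses of one isolated class check and cover -/
def isoCheck (i : Nat) (wj : List Nat) (wv : List (List (List Int))) : Bool :=
  wv.length == 31 && witCovers i wj && (List.range 31).all (witCheck i wj wv)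

/-! ## The theorems -/

/-- (D) the data are well-formed -/
theorem data_wellformed :
    (isSquare12 J && antisym theta0 && cls.length == 32 && cls.all antisym &&
     (List.range 16).all (fun a => cls.getD (2 * a + 1) [] == neg (cls.getD (2 * a) [])) &&
     isolatedIdx.length == 8 && isolatedIdx.all (fun i => i < 32 && i % 2 == 0)) = true := by
  decide +kernel

/-- (Θ) `Θ₀ = pt_x + pt_y + E_α` is ample: its positivity form is positive definite -/
theorem theta0_positive_definite : thetaCheck = true := by
  decide +kernel

/-- (I) for the isolated class `isolatedIdx[0]`: every difference to another class has a 4-dimensional negative definite subspace -/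
theorem isolation_0 : isoCheck (isolatedIdx.getD 0 99) witJ0 witV0 = true := by decide +kernel
/-- (I) for `isolatedIdx[1]` -/
theorem isolation_1 : isoCheck (isolatedIdx.getD 1 99) witJ1 witV1 = true := by decide +kernel
/-- (I) for `isolatedIdx[2]` -/
theorem isolation_2 : isoCheck (isolatedIdx.getD 2 99) witJ2 witV2 = true := by decide +kernel
/-- (I) for `isolatedIdx[3]` -/
theorem isolation_3 : isoCheck (isolatedIdx.getD 3 99) witJ3 witV3 = true := by decide +kernel
/-- (I) for `isolatedIdx[4]` -/
theorem isolation_4 : isoCheck (isolatedIdx.getD 4 99) witJ4 witV4 = true := by decide +kernel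
/-- (I) for `isolatedIdx[5]` -/
theorem isolation_5 : isoCheck (isolatedIdx.getD 5 99) witJ5 witV5 = true := by decide +kernel
/-- (I) for `isolatedIdx[6]` -/
theorem isolation_6 : isoCheck (isolatedIdx.getD 6 99) witJ6 witV6 = true := by decide +kernel
/-- (I) for `isolatedIdx[7]` -/
theorem isolation_7 : isoCheck (isolatedIdx.getD 7 99) witJ7 witV7 = true := by decide +kernel

/-- (I), assembled: each of the eight classes `Γ_a + Γ′_a` has complex index ≥ 2 against every other class of the rank-32 shape —
with Mumford's index theorem, `Hom = Ext¹ = 0` to every other piece: the eight positive pieces are isolated (page §6.2, Corollary 7′) -/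
theorem isolation_all :
    (isoCheck (isolatedIdx.getD 0 99) witJ0 witV0 && isoCheck (isolatedIdx.getD 1 99) witJ1 witV1 &&
     isoCheck (isolatedIdx.getD 2 99) witJ2 witV2 && isoCheck (isolatedIdx.getD 3 99) witJ3 witV3 &&
     isoCheck (isolatedIdx.getD 4 99) witJ4 witV4 && isoCheck (isolatedIdx.getD 5 99) witJ5 witV5 &&
     isoCheck (isolatedIdx.getD 6 99) witJ6 witV6 && isoCheck (isolatedIdx.getD 7 99) witJ7 witV7) = true := by
  simp only [isolation_0, isolation_1, isolation_2, isolation_3, isolation_4, isolation_5, isolation_6, isolation_7, Bool.and_self]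

end HodgeRepro0.P4RowDIsolation
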